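import Summits.QuantumFields.YangMills.Theorems.UnitScaleTiltHistoryTailLaneTailChiDisplays
import Summits.QuantumFields.YangMills.Theorems.AlphaInputsT3ACMinimiserPinConsts
import Summits.QuantumFields.YangMills.Theorems.AlphaInputsT3ACMinimiserPinThm1
import HarnessLib

/-!
# `UnitScaleTiltHistoryTailOneSupplier` — THE CRUX `HistoryTailL` FROM 19200's T8 TEXT AND THE TWO SUPPLIER ROWS OF THE 2′χ DISPLAY, BY NAME: the (T) row
# `Thm1GlobalMinAt L a₀ a₁ 𝔠.B₃` of `PinnedPartsT3ACRecFLChi L` is NOT separate content — it is [Balaban1985Variational] Thm 1 in the global reading AT ANY constants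
# (`∃ a₀ a₁ B₃ > 0`, the first half of v5kC's `stub_thm1In8GlobalMin`, fed by 19200's v8 leaves through ★r1 g5's `InteriorExcision.thm1In8GlobalMin_of_v8Leaves`),
# transported to the record's constants by the antitone∕monotone bookkeeping — cell `ym3-torus`, route `UnitScaleTilt`, crux stmt-QuantumFields-19936 (skeleton v5p9,
# ONE stub 2′χ `stub_laneRecordsV3Chi`), width seat `ym-ust-19936-w5` (g0)

WHY.  OWNER ruling g21-№4 §C («do not staff `Thm1GlobalMinAt` separately — it follows in two lines», alpha-1 g6's `MinimiserPinThm1`) and DEPMAP v3.4 (α) («the open analytic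
content of 2′χ is (FL)») presuppose that the (T) row inside the display of record `AlphaInputsT3AC.PinnedPartsT3ACRecFLChi L` (w2 g0, `…v3RecordXChi` §3) is met by 19200's
line.  The display, however, asks for (T) at the RECORD's constants `(a₀, a₁, 𝔠.B₃)` which must ALSO satisfy [7]'s small-`a₁` rows (`143·(7²/4)²·2B₃a₁ ≤ ⅓`,
`4B₃a₁ ≤ 2δ_SU(2)/(7L)²`), `B₃a₁ ≤ a₀`, `1 ≤ 2B₃`, and whatever floor `B₀` the (FL) supplier needs (negation g28b: (FL)@B is false for `2B < 1`; OWNER 23:33:27Z: `B_lin`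
may be `M₁`-polynomial), while 19200 delivers (T) at ITS OWN `(a₀, a₁, B₃)` (`B₃ > 4`).  The landed shell `pinnedPartsT3ACRecR_shell` fixes `B₃ := 1`, `a₀ = a₁ = a₁(L)` and
cannot absorb that.  THIS FILE closes the gap once and for all:
* §1 `innerFineLiftsT3_mono` — (FL) `InnerFineLiftsT3 … B` is MONOTONE in `B` (a larger constant is a weaker row; `θBal > 0` on the record window).
* §2 `exists_small_window` — at ANY prescribed `B > 0` and ceilings `A₀, A₁ > 0` there are [7] constants `0 < a₀ ≤ A₀`, `0 < a₁ ≤ A₁` with `B·a₁ ≤ a₀` and both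
  small-`a₁` rows (pure arithmetic: `a₀ := A₀`, `a₁ := min A₁ (min A₀ a₁(L) / B)`).
* §3 ★★ `pinnedPartsT3ACRecFLChi_of_thm1_rows` — **the display of record from (T) at ANY constants plus the SUPPLIER ROWS**: if `∃ a₀ a₁ B₃ > 0, Thm1GlobalMinAt L a₀ a₁ B₃`
  and if, for every `B` above a supplier-chosen floor `B₀` (with `1 ≤ 2B`) and every `(a₀, a₁)` in a supplier-chosen box `(0, A₀] × (0, A₁]` satisfying `B·a₁ ≤ a₀`, the two
  small-`a₁` rows and `Thm1GlobalMinAt L a₀ a₁ B` (all USABLE by the supplier), there are thresholds `(b₁, p₁)` beyond which every profile `(b₀, p₀)` is served by a record `𝔠`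
  with EXACTLY that profile, `𝔠.B₃ = B`, the three `C68`-rows, `7L + 3 ≤ M₁` (these four are free for any seed: `exists_record_sizes_M₁`), and per family (FL) at `𝔠.B₃` and
  (O″χ) the χ data rows — then `PinnedPartsT3ACRecFLChi L`.  Proof: `B := max (max B₃ᵀ B₀) ½`, §2 at ceilings `min A₀ a₀ᵀ`, `min A₁ a₁ᵀ`, then
  `MinimiserPin.thm1GlobalMinAt_anti` ∕ `thm1GlobalMinAt_mono`.  ★★ `alphaInputsT3ACv3RecChi_of_thm1_rows` — the registered 2′χ text from the same (serves 20520's v5kC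
  identically: 2′χ's inner (T) row is T8's first half there too).
* §4 ★★★ `historyTailL_of_thm1In8_rows_allL` — **`HistoryTailL` ⇐ ⟨v5kC's `stub_thm1In8GlobalMin` TEXT VERBATIM⟩ ∧ (∀ odd `L > 1`, the supplier rows)** (w2 g0's
  `HistoryTailLaneTailChi.historyTailL_of_pinnedPartsRecFLChi`).  With ★r1 g5's `thm1In8GlobalMin_of_v8Leaves` ∕ `…_of_v8Leaves4` the first hypothesis is 19200's four open v8
  leaves BY NAME; so the open content of stmt-QuantumFields-19936 is, by name, {19200's leaves, (FL) at some floor `B₀(L)`, (O″χ) = NODE O's χ data rows} and nothing else.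
SUPPLIER READING of the rows hypothesis: the (O″χ) supplier (★alpha-1 ∕ NODE O) keeps full control of the record — it is handed `B`, `a₀`, `a₁` in its own regime box and the usable
facts above, seeds `exists_record_sizes_M₁` with its true constants and `B₃ := B`, and proves the χ data rows for the profile-adjusted seed; a kinematic (FL) theorem «for every
record with `B_FL(L, M₁) ≤ B₃` (and the record's window), `InnerFineLiftsT3 … B₃`» (w1 g0 ∕ ★alpha-2 g5) slots in with `B₀ := max ½ (B_FL(L, M₁*))` for the seed's `M₁*` via §1.
HONEST FRAMING.  Bookkeeping∕composition of landed theorems (restriction of quantifiers, one arithmetic witness); (T), (FL), (O″χ) and T8 stay HYPOTHESES (never asserted);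
nothing of [Balaban1985UV3]'s cluster expansion or of [Balaban1985Variational] is proved; def-free; count-neutral helper (`--supports stmt-QuantumFields-19936`); registry
untouched.  YM₃ on the three-torus is rung R3 of the programme (UV stability ∕ continuum limit on T³), NOT the Clay problem: nothing here is a claim about d = 4, infinite
volume, or a mass gap.

References: T. Bałaban, Commun. Math. Phys. 102 (1985) 277–309 [Balaban1985Variational] (Thm 1 (6)–(8) pp.278–279, Prop 7 p.299, Prop 8 p.304); Commun. Math. Phys. 102
(1985) 255–275 [Balaban1985UV3] ((5) p.256, (7) p.257, (40)–(42) p.266, (47) p.267, (68) p.273, (71) p.273, Thm 2 p.272); C. King, Commun. Math. Phys. 102 (1986) 649–677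
[King1986] ((3.12) p.657).
-/

set_option autoImplicit false

noncomputable section

namespace Summit.QuantumFields.YangMills.Theorems.HistoryTailOneSupplier

open MeasureTheory Set
open scoped Matrix.Norms.L2Operator
open Literature.MathematicalPhysics.QuantumFieldTheory.Balaban1983to89
open Literature.MathematicalPhysics.QuantumFieldTheory.Balaban1983to89.T3ContinuumYM3Torus
open Literature.MathematicalPhysics.QuantumFieldTheory.Balaban1983to89.T3UnitScaleTilt (θBal)
open Literature.MathematicalPhysics.QuantumFieldTheory.Balaban1983to89.T3MinimiserStabilityReduction (θBal_pos)
open Literature.MathematicalPhysics.QuantumFieldTheory.Balaban1983to89.T3PrintedMinimiserExistence (Thm1GlobalMinAt)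
open Literature.MathematicalPhysics.QuantumFieldTheory.Balaban1983to89.T3LowerAlongMinimisersSplit (MinimisersIn8At)
open Literature.MathematicalPhysics.QuantumFieldTheory.Balaban1983to89.ExpMeanLog (deltaSU deltaSU_pos)
open Literature.MathematicalPhysics.QuantumFieldTheory.Balaban1985CMP102.Setting
open Summit.QuantumFields.Balaban3D.Carriers
open Summit.QuantumFields.Balaban3D.Proofs.Primitives
open Summit.QuantumFields.Balaban3D.Proofs.Thresholds (Q0 Q0_pos)
open B7Prop2Explicit (C0 C0_pos)

/-! ## §1 (FL) is monotone in its constant -/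

/-- **(FL) IS MONOTONE IN ITS CONSTANT**: `InnerFineLiftsT3 … K B → B ≤ B' → InnerFineLiftsT3 … K B'` — the same witness, the plaquette bound relaxed (the window factor
`2L²·avgWindowFactor·θ(K−k+1)` is positive on the record's coupling window, `θBal_pos`).  So a supplier's (FL) at its own floor serves every record with a larger `B₃`.
[cite: Balaban1985Variational, Thm 1 (8) p.279 (the rôle of `B₃`); Balaban1985UV3, (7) p.257] -/
theorem innerFineLiftsT3_mono {F : T3Family} {𝔠 : AlphaConsts F.L (suGroupModel 2).N} {γ : ℝ} {hγ : 0 < γ}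
    {hγ1 : γ ≤ (min 𝔠.gamma0 1) ^ 2} {K : ℕ} {B B' : ℝ}
    (hFL : AlphaInputsT3AC.InnerFineLiftsT3 F 𝔠 γ hγ hγ1 K B) (hBB' : B ≤ B') :
    AlphaInputsT3AC.InnerFineLiftsT3 F 𝔠 γ hγ hγ1 K B' := by
  intro k hk h hadm hne W hW
  obtain ⟨U, hU, hq⟩ := hFL k hk h hadm hne W hW
  refine ⟨U, hU, fun q hq' => (hq q hq').trans_le ?_⟩
  have hA := avgWindowFactor_pos F
  have hθ : 0 < θBal F.L γ 𝔠.b₀ 𝔠.p₀ (K - k + 1) :=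
    θBal_pos F.hL.2.le hγ (hγ1.trans (sq_min_one_le _ 𝔠.gamma0_pos)) 𝔠.b₀_pos 𝔠.p₀ _
  have h1 : 0 ≤ 2 * (F.L : ℝ) ^ 2 * avgWindowFactor F.L * θBal F.L γ 𝔠.b₀ 𝔠.p₀ (K - k + 1) := by positivity
  have h2 : 0 ≤ (((F.L : ℝ) ^ k)⁻¹) ^ 2 := by positivity
  exact mul_le_mul_of_nonneg_right (mul_le_mul_of_nonneg_right hBB' h1) h2

/-! ## §2 The [7]-constants box at a prescribed `B` -/

/-- **[7] CONSTANTS INSIDE ANY BOX AT ANY PRESCRIBED `B > 0`**: for ceilings `A₀, A₁ > 0` there are `0 < a₀ ≤ A₀`, `0 < a₁ ≤ A₁` with `B·a₁ ≤ a₀` and the two small-`a₁`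
rows of the 2′χ display (`143·(7²/4)²·2Ba₁ ≤ ⅓`, `4Ba₁ ≤ 2δ_SU(2)/(7L)²`) — `a₀ := A₀`, `a₁ := min A₁ (min A₀ a₁(L) / B)` with alpha-1's `a₁(L)` (`a₁Witness_pos`).
Pure arithmetic. [cite: Balaban1985Variational, Thm 1 p.279 («a₀, a₁ sufficiently small, B₃a₁ ≤ a₀»)] -/
theorem exists_small_window {L : ℕ} (hL : 1 < L) {B A₀ A₁ : ℝ} (hB : 0 < B) (hA₀ : 0 < A₀) (hA₁ : 0 < A₁) :
    ∃ a₀ a₁ : ℝ, 0 < a₀ ∧ a₀ ≤ A₀ ∧ 0 < a₁ ∧ a₁ ≤ A₁ ∧ B * a₁ ≤ a₀ ∧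
      (143 * ((((3 + 4 : ℕ) : ℝ)) ^ 2 / 4) ^ 2) * (2 * (B * a₁)) ≤ 1 / 3 ∧
      2 * (2 * (B * a₁)) ≤ 2 * deltaSU (Fin 2) / (((3 + 4) * L : ℕ) : ℝ) ^ 2 := by
  set s : ℝ := min (1 / (6 * (143 * ((((3 + 4 : ℕ) : ℝ)) ^ 2 / 4) ^ 2))) (deltaSU (Fin 2) / (2 * (((3 + 4) * L : ℕ) : ℝ) ^ 2))
    with hs_def
  have hs : 0 < s := AlphaInputsT3AC.a₁Witness_pos L hL
  have hK : (0 : ℝ) < 143 * ((((3 + 4 : ℕ) : ℝ)) ^ 2 / 4) ^ 2 := by positivity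
  have h7L : (0 : ℝ) < (((3 + 4) * L : ℕ) : ℝ) ^ 2 := by
    have : 0 < (3 + 4) * L := by omega
    have h : (0 : ℝ) < (((3 + 4) * L : ℕ) : ℝ) := by exact_mod_cast this
    positivity
  refine ⟨A₀, min A₁ (min A₀ s / B), hA₀, le_rfl, lt_min hA₁ (div_pos (lt_min hA₀ hs) hB), min_le_left _ _, ?_, ?_, ?_⟩
  · -- `B·a₁ ≤ A₀`
    calc B * min A₁ (min A₀ s / B) ≤ B * (min A₀ s / B) := by gcongr; exact min_le_right _ _
      _ = min A₀ s := by field_simp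
      _ ≤ A₀ := min_le_left _ _
  · have hle : B * min A₁ (min A₀ s / B) ≤ 1 / (6 * (143 * ((((3 + 4 : ℕ) : ℝ)) ^ 2 / 4) ^ 2)) := by
      calc B * min A₁ (min A₀ s / B) ≤ B * (min A₀ s / B) := by gcongr; exact min_le_right _ _
        _ = min A₀ s := by field_simp
        _ ≤ s := min_le_right _ _
        _ ≤ _ := min_le_left _ _
    calc 143 * ((((3 + 4 : ℕ) : ℝ)) ^ 2 / 4) ^ 2 * (2 * (B * min A₁ (min A₀ s / B)))
        ≤ 143 * ((((3 + 4 : ℕ) : ℝ)) ^ 2 / 4) ^ 2 * (2 * (1 / (6 * (143 * ((((3 + 4 : ℕ) : ℝ)) ^ 2 / 4) ^ 2)))) := by gcongr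
      _ = 1 / 3 := by field_simp; ring
  · have hle : B * min A₁ (min A₀ s / B) ≤ deltaSU (Fin 2) / (2 * (((3 + 4) * L : ℕ) : ℝ) ^ 2) := by
      calc B * min A₁ (min A₀ s / B) ≤ B * (min A₀ s / B) := by gcongr; exact min_le_right _ _
        _ = min A₀ s := by field_simp
        _ ≤ s := min_le_right _ _
        _ ≤ _ := min_le_right _ _
    calc 2 * (2 * (B * min A₁ (min A₀ s / B))) ≤ 2 * (2 * (deltaSU (Fin 2) / (2 * (((3 + 4) * L : ℕ) : ℝ) ^ 2))) := by gcongr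
      _ = 2 * deltaSU (Fin 2) / (((3 + 4) * L : ℕ) : ℝ) ^ 2 := by field_simp

/-! ## §3 The display of record from (T) at any constants and the supplier rows -/

/-- ★★ **THE 2′χ DISPLAY OF RECORD FROM (T) AT ANY CONSTANTS AND THE SUPPLIER ROWS.**  Hypotheses: `hT` — [Balaban1985Variational] Thm 1 (global reading) at SOME
`(a₀, a₁, B₃) > 0` (the first half of v5kC's T8 text; 19200's line); `hrows` — for every `B ≥ B₀` with `1 ≤ 2B` and every `(a₀, a₁) ∈ (0, A₀] × (0, A₁]` with `B·a₁ ≤ a₀`, the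
two small-`a₁` rows and `Thm1GlobalMinAt L a₀ a₁ B` (usable), thresholds `(b₁, p₁)` beyond which every profile is served by a record with exactly that profile, `B₃ = B`, the three
`C68`-rows, `7L + 3 ≤ M₁`, and per family (FL) `InnerFineLiftsT3 … B₃` and (O″χ) the χ data rows for some pinned trivial-history minimiser family whenever one exists.
Conclusion: `PinnedPartsT3ACRecFLChi L`.  (`B := max (max B₃ᵀ B₀) ½`; §2; `thm1GlobalMinAt_anti`∕`_mono`.)
[cite: Balaban1985Variational, Thm 1 (6)–(8) pp.278–279; Balaban1985UV3, (7) p.257, (40)–(42) p.266, (47) p.267, (68) p.273 and Thm 2 p.272] -/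
theorem pinnedPartsT3ACRecFLChi_of_thm1_rows {L : ℕ} (hL : 1 < L)
    (hT : ∃ a₀ a₁ B₃ : ℝ, 0 < a₀ ∧ 0 < a₁ ∧ 0 < B₃ ∧ Thm1GlobalMinAt L a₀ a₁ B₃)
    {B₀ A₀ A₁ : ℝ} (hA₀ : 0 < A₀) (hA₁ : 0 < A₁)
    (hrows : ∀ (B a₀ a₁ : ℝ), B₀ ≤ B → 1 ≤ 2 * B → 0 < a₀ → a₀ ≤ A₀ → 0 < a₁ → a₁ ≤ A₁ → B * a₁ ≤ a₀ →
      (143 * ((((3 + 4 : ℕ) : ℝ)) ^ 2 / 4) ^ 2) * (2 * (B * a₁)) ≤ 1 / 3 →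
      2 * (2 * (B * a₁)) ≤ 2 * deltaSU (Fin 2) / (((3 + 4) * L : ℕ) : ℝ) ^ 2 →
      Thm1GlobalMinAt L a₀ a₁ B →
      ∃ (b₁ p₁ : ℝ), ∀ (b₀ p₀ : ℝ), b₁ ≤ b₀ → p₁ ≤ p₀ →
        ∃ 𝔠 : AlphaConsts L (suGroupModel 2).N, 𝔠.b₀ = b₀ ∧ 𝔠.p₀ = p₀ ∧ 𝔠.B₃ = B ∧
          4 * 𝔠.B₃ * (L : ℝ) ^ 2 * avgWindowFactor L ≤ 𝔠.C68 ∧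
          Real.exp (𝔠.p₀ - 1) ≤ 3 * C0 3 * 𝔠.C68 * (𝔠.b₀ * Q0 𝔠.p₀) ∧
          (𝔠.b₀ * Q0 𝔠.p₀) * (2 * (L : ℝ) ^ 2 * avgWindowFactor L) ^ 2 ≤ 3 * C0 3 * 𝔠.C68 * a₁ ^ 2 ∧
          7 * L + 3 ≤ 𝔠.M₁ ∧
          ∀ (F : T3Family) (hF : F.L = L),
            (∀ (γ : ℝ) (hγ : 0 < γ) (hγ1 : γ ≤ (min (hF ▸ 𝔠).gamma0 1) ^ 2) (K : ℕ),
              AlphaInputsT3AC.InnerFineLiftsT3 F (hF ▸ 𝔠) γ hγ hγ1 K (hF ▸ 𝔠).B₃) ∧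
            (∀ (γ : ℝ) (hγ : 0 < γ) (hγ1 : γ ≤ (min (hF ▸ 𝔠).gamma0 1) ^ 2) (K : ℕ),
              (∃ Ut : (k : ℕ) → GaugeField (F.P K) k (Matrix.specialUnitaryGroup (Fin 2) ℂ) →
                  GaugeField (F.P K) 0 (Matrix.specialUnitaryGroup (Fin 2) ℂ),
                AlphaInputsT3AC.TrivMinimiserRowsT3 F (hF ▸ 𝔠) γ hγ hγ1 a₀ a₁ K Ut) →
              ∃ Ut : (k : ℕ) → GaugeField (F.P K) k (Matrix.specialUnitaryGroup (Fin 2) ℂ) →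
                  GaugeField (F.P K) 0 (Matrix.specialUnitaryGroup (Fin 2) ℂ),
                AlphaInputsT3AC.TrivMinimiserRowsT3 F (hF ▸ 𝔠) γ hγ hγ1 a₀ a₁ K Ut ∧
                  AlphaInputsT3AC.DataRowsT3XChi F (hF ▸ 𝔠) γ hγ hγ1 K Ut)) :
    AlphaInputsT3AC.PinnedPartsT3ACRecFLChi L := by
  obtain ⟨aT₀, aT₁, BT, haT₀, haT₁, hBT, hT⟩ := hT
  -- the record's `B₃`: above 19200's `B₃`, the supplier's floor and `½`
  set B : ℝ := max (max BT B₀) (1 / 2) with hB_def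
  have hBT_le : BT ≤ B := (le_max_left _ _).trans (le_max_left _ _)
  have hB₀_le : B₀ ≤ B := (le_max_right _ _).trans (le_max_left _ _)
  have hBhalf : 1 / 2 ≤ B := le_max_right _ _
  have hBpos : 0 < B := lt_of_lt_of_le (by norm_num) hBhalf
  have h2B : 1 ≤ 2 * B := by linarith
  -- the [7] constants inside the box and below 19200's
  obtain ⟨a₀, a₁, ha₀, ha₀A, ha₁, ha₁A, hwin, hA3, hA2⟩ :=
    exists_small_window hL hBpos (lt_min hA₀ haT₀) (lt_min hA₁ haT₁)
  have hT' : Thm1GlobalMinAt L a₀ a₁ B :=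
    MinimiserPin.thm1GlobalMinAt_mono
      (MinimiserPin.thm1GlobalMinAt_anti hT (ha₀A.trans (min_le_right _ _)) (ha₁A.trans (min_le_right _ _))) le_rfl hBT_le
  obtain ⟨b₁, p₁, hrec⟩ := hrows B a₀ a₁ hB₀_le h2B ha₀ (ha₀A.trans (min_le_left _ _)) ha₁ (ha₁A.trans (min_le_left _ _))
    hwin hA3 hA2 hT'
  refine ⟨b₁, p₁, fun b₀ p₀ hb hp => ?_⟩
  obtain ⟨𝔠, h1, h2, hB3, s1, s2, s3, s4, hFO⟩ := hrec b₀ p₀ hb hp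
  refine ⟨𝔠, a₀, a₁, h1, h2, ha₀, ha₁, by rw [hB3]; exact hwin, by rw [hB3]; exact hA3, by rw [hB3]; exact hA2,
    by rw [hB3]; exact h2B, s1, s2, s3, s4, by rw [hB3]; exact hT', fun F hF => hFO F hF⟩


/-- ★★ **THE REGISTERED 2′χ TEXT `AlphaInputsT3ACv3RecChi L` FROM (T) AT ANY CONSTANTS AND THE SUPPLIER ROWS** (§3 through w2 g0's
`alphaInputsT3ACv3RecChi_of_pinnedPartsRecFLChi`); shared verbatim by 20520's v5kC, whose T8 stub supplies `hT`.
[cite: Balaban1985UV3, Thm 2 p.272 and (47) p.267; Balaban1985Variational, Thm 1 (8) p.279] -/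
theorem alphaInputsT3ACv3RecChi_of_thm1_rows {L : ℕ} (hL : 1 < L)
    (hT : ∃ a₀ a₁ B₃ : ℝ, 0 < a₀ ∧ 0 < a₁ ∧ 0 < B₃ ∧ Thm1GlobalMinAt L a₀ a₁ B₃)
    {B₀ A₀ A₁ : ℝ} (hA₀ : 0 < A₀) (hA₁ : 0 < A₁)
    (hrows : ∀ (B a₀ a₁ : ℝ), B₀ ≤ B → 1 ≤ 2 * B → 0 < a₀ → a₀ ≤ A₀ → 0 < a₁ → a₁ ≤ A₁ → B * a₁ ≤ a₀ →
        (143 * ((((3 + 4 : ℕ) : ℝ)) ^ 2 / 4) ^ 2) * (2 * (B * a₁)) ≤ 1 / 3 →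
        2 * (2 * (B * a₁)) ≤ 2 * deltaSU (Fin 2) / (((3 + 4) * L : ℕ) : ℝ) ^ 2 →
        Thm1GlobalMinAt L a₀ a₁ B →
        ∃ (b₁ p₁ : ℝ), ∀ (b₀ p₀ : ℝ), b₁ ≤ b₀ → p₁ ≤ p₀ →
          ∃ 𝔠 : AlphaConsts L (suGroupModel 2).N, 𝔠.b₀ = b₀ ∧ 𝔠.p₀ = p₀ ∧ 𝔠.B₃ = B ∧
            4 * 𝔠.B₃ * (L : ℝ) ^ 2 * avgWindowFactor L ≤ 𝔠.C68 ∧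
            Real.exp (𝔠.p₀ - 1) ≤ 3 * C0 3 * 𝔠.C68 * (𝔠.b₀ * Q0 𝔠.p₀) ∧
            (𝔠.b₀ * Q0 𝔠.p₀) * (2 * (L : ℝ) ^ 2 * avgWindowFactor L) ^ 2 ≤ 3 * C0 3 * 𝔠.C68 * a₁ ^ 2 ∧
            7 * L + 3 ≤ 𝔠.M₁ ∧
            ∀ (F : T3Family) (hF : F.L = L),
              (∀ (γ : ℝ) (hγ : 0 < γ) (hγ1 : γ ≤ (min (hF ▸ 𝔠).gamma0 1) ^ 2) (K : ℕ),
                AlphaInputsT3AC.InnerFineLiftsT3 F (hF ▸ 𝔠) γ hγ hγ1 K (hF ▸ 𝔠).B₃) ∧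
              (∀ (γ : ℝ) (hγ : 0 < γ) (hγ1 : γ ≤ (min (hF ▸ 𝔠).gamma0 1) ^ 2) (K : ℕ),
                (∃ Ut : (k : ℕ) → GaugeField (F.P K) k (Matrix.specialUnitaryGroup (Fin 2) ℂ) →
                    GaugeField (F.P K) 0 (Matrix.specialUnitaryGroup (Fin 2) ℂ),
                  AlphaInputsT3AC.TrivMinimiserRowsT3 F (hF ▸ 𝔠) γ hγ hγ1 a₀ a₁ K Ut) →
                ∃ Ut : (k : ℕ) → GaugeField (F.P K) k (Matrix.specialUnitaryGroup (Fin 2) ℂ) →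
                    GaugeField (F.P K) 0 (Matrix.specialUnitaryGroup (Fin 2) ℂ),
                  AlphaInputsT3AC.TrivMinimiserRowsT3 F (hF ▸ 𝔠) γ hγ hγ1 a₀ a₁ K Ut ∧
                    AlphaInputsT3AC.DataRowsT3XChi F (hF ▸ 𝔠) γ hγ hγ1 K Ut)) :
    AlphaInputsT3ACv3RecChi L :=
  alphaInputsT3ACv3RecChi_of_pinnedPartsRecFLChi (pinnedPartsT3ACRecFLChi_of_thm1_rows hL hT hA₀ hA₁ hrows)

/-! ## §4 The crux from T8's text and the supplier rows at every odd block size -/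

/-- ★★★ **`HistoryTailL` ⇐ ⟨v5kC's `stub_thm1In8GlobalMin` TEXT⟩ ∧ (∀ odd `L > 1`, THE SUPPLIER ROWS)** — stmt-QuantumFields-19936 BY NAME from 19200's T8 text (whose
`MinimisersIn8At` half is not even used) and, at every odd block size, a floor `B₀` and a box `(0, A₀] × (0, A₁]` on which the (FL) + (O″χ) rows are served (§3, then w2 g0's
`historyTailL_of_pinnedPartsRecFLChi`).  Compose with ★r1 g5's `InteriorExcision.thm1In8GlobalMin_of_v8Leaves(4)` to read the first hypothesis as 19200's open v8 leaves.
[cite: Balaban1985UV3, (5) p.256, (47) p.267, (71) p.273 and Thm 2 p.272; Balaban1985Variational, Thm 1 (8) p.279 and Prop 8 p.304; King1986, (3.12) p.657] -/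
theorem historyTailL_of_thm1In8_rows_allL
    (hT8 : ∀ L : ℕ, Odd L → 1 < L → ∃ a₀ a₁ B₃ : ℝ, 0 < a₀ ∧ 0 < a₁ ∧ 0 < B₃ ∧
      Thm1GlobalMinAt L a₀ a₁ B₃ ∧ MinimisersIn8At L a₀ a₁ B₃)
    (hrows : ∀ L : ℕ, Odd L → 1 < L → ∃ (B₀ A₀ A₁ : ℝ), 0 < A₀ ∧ 0 < A₁ ∧
      ∀ (B a₀ a₁ : ℝ), B₀ ≤ B → 1 ≤ 2 * B → 0 < a₀ → a₀ ≤ A₀ → 0 < a₁ → a₁ ≤ A₁ → B * a₁ ≤ a₀ →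
        (143 * ((((3 + 4 : ℕ) : ℝ)) ^ 2 / 4) ^ 2) * (2 * (B * a₁)) ≤ 1 / 3 →
        2 * (2 * (B * a₁)) ≤ 2 * deltaSU (Fin 2) / (((3 + 4) * L : ℕ) : ℝ) ^ 2 →
        Thm1GlobalMinAt L a₀ a₁ B →
        ∃ (b₁ p₁ : ℝ), ∀ (b₀ p₀ : ℝ), b₁ ≤ b₀ → p₁ ≤ p₀ →
          ∃ 𝔠 : AlphaConsts L (suGroupModel 2).N, 𝔠.b₀ = b₀ ∧ 𝔠.p₀ = p₀ ∧ 𝔠.B₃ = B ∧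
            4 * 𝔠.B₃ * (L : ℝ) ^ 2 * avgWindowFactor L ≤ 𝔠.C68 ∧
            Real.exp (𝔠.p₀ - 1) ≤ 3 * C0 3 * 𝔠.C68 * (𝔠.b₀ * Q0 𝔠.p₀) ∧
            (𝔠.b₀ * Q0 𝔠.p₀) * (2 * (L : ℝ) ^ 2 * avgWindowFactor L) ^ 2 ≤ 3 * C0 3 * 𝔠.C68 * a₁ ^ 2 ∧
            7 * L + 3 ≤ 𝔠.M₁ ∧
            ∀ (F : T3Family) (hF : F.L = L),
              (∀ (γ : ℝ) (hγ : 0 < γ) (hγ1 : γ ≤ (min (hF ▸ 𝔠).gamma0 1) ^ 2) (K : ℕ),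
                AlphaInputsT3AC.InnerFineLiftsT3 F (hF ▸ 𝔠) γ hγ hγ1 K (hF ▸ 𝔠).B₃) ∧
              (∀ (γ : ℝ) (hγ : 0 < γ) (hγ1 : γ ≤ (min (hF ▸ 𝔠).gamma0 1) ^ 2) (K : ℕ),
                (∃ Ut : (k : ℕ) → GaugeField (F.P K) k (Matrix.specialUnitaryGroup (Fin 2) ℂ) →
                    GaugeField (F.P K) 0 (Matrix.specialUnitaryGroup (Fin 2) ℂ),
                  AlphaInputsT3AC.TrivMinimiserRowsT3 F (hF ▸ 𝔠) γ hγ hγ1 a₀ a₁ K Ut) →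
                ∃ Ut : (k : ℕ) → GaugeField (F.P K) k (Matrix.specialUnitaryGroup (Fin 2) ℂ) →
                    GaugeField (F.P K) 0 (Matrix.specialUnitaryGroup (Fin 2) ℂ),
                  AlphaInputsT3AC.TrivMinimiserRowsT3 F (hF ▸ 𝔠) γ hγ hγ1 a₀ a₁ K Ut ∧
                    AlphaInputsT3AC.DataRowsT3XChi F (hF ▸ 𝔠) γ hγ hγ1 K Ut)) :
    Summit.QuantumFields.YangMills.Theses.UnitScaleTilt.HistoryTailL := by
  refine HistoryTailLaneTailChi.historyTailL_of_pinnedPartsRecFLChi fun L hLo hL => ?_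
  obtain ⟨a₀, a₁, B₃, ha₀, ha₁, hB₃, hT, -⟩ := hT8 L hLo hL
  obtain ⟨B₀, A₀, A₁, hA₀, hA₁, h⟩ := hrows L hLo hL
  exact pinnedPartsT3ACRecFLChi_of_thm1_rows hL ⟨a₀, a₁, B₃, ha₀, ha₁, hB₃, hT⟩ hA₀ hA₁ h

end Summit.QuantumFields.YangMills.Theorems.HistoryTailOneSupplier

end
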